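import Summits.Ventures.WeilGRH.TwistedFlatTest
import HarnessLib

/-!
# GRH arm (rh-explicit, venture WeilGRH): MODULATED flat windows — a `χ`-rung bounds every twisted
  smoothed prime sum below its horizon, at every height `τ`

Cell `rh-explicit`, WEIL TRACK (structure seat weil-3, gen7) for the GRH ARM.  Sequel of `TwistedFlatTest.lean`
(the flat window `χ_0`).  Modulating a window by `e^{iτx}` rotates every twist: for all `u`, `ω`, `t`,

  `D^ω_t(e^{iτ·}u) = D^{ω e^{−iτt}}_t(u)`     (`weilTwistIncrement_modulate`),

so the twisted window form of `u_τ = e^{iτx}χ_0` (a smooth-inside window function for EVERY real `τ`) is,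
in closed form (`twistedWindowForm_modulated_chi_zero`),

  `𝓔^χ_a(u_τ) − M^χ_a = log q − [2Σ_{log n<2a} Λ(n)n^{-1/2}(1 − log n/(2a)) Re(χ(n) n^{iτ}) + K_κ`
      `− ∫₀^∞ ρ_κ(t) (2(1 − cos τt) + cos(τt)·min(t,2a)/a) dt]`

(`n^{iτ} = e^{iτ log n}`; at `τ = 0` this is `TwistedFlatTest.twistedWindowForm_chi_zero`).  Hence the
**MODULATED FLAT-WINDOW INEQUALITY** (`modulatedFlatWindow_le_log_of_weilPositivityOnChar`): for every `χ`
mod `q ≠ 1`, every `a > 0` and EVERY `τ ∈ ℝ`,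

  `WeilPositivityOnChar χ a ⟹ 2Σ_{log n<2a} Λ(n)n^{-1/2}(1 − log n/(2a)) Re(χ(n)n^{iτ})`
      `≤ log q − K_κ + ∫₀^∞ ρ_κ(t)(2(1 − cos τt) + cos(τt) min(t,2a)/a) dt`:

the rung at `a` is (among other things) a UNIFORM family of upper bounds for the twisted prime sums
`Σ_{n<x} Λ(n)χ(n)n^{-1/2+iτ}(1 − log n/log x)`, `x = e^{2a}`, in which the conductor enters exactly as `log q`
and the height exactly as the archimedean cost `∫ρ_κ·2(1 − cos τt)` (`≍ log(2+|τ|)`) — GRH-strength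
cancellation below the horizon, at every height, as a consequence of ONE rung.  In key space: the rung's
compatible keys lie in every half-space obtained from the flat one by the rotation `χ(n) ↦ χ(n)n^{iτ}`.
RH/GRH-free; `…_of_grh`: under `GRH(χ)` (primitive `χ`) at every `a` and `τ`.

No definitions, no named facts.

## References

* H. Yoshida, *On Hermitian forms attached to zeta functions*, Adv. Stud. Pure Math. 21 (1992), §3.
  [Yoshida1992]
* A. Weil, *Sur les "formules explicites" de la théorie des nombres premiers* (1952), (11) pp. 261–262.
  [Weil1952FormulesExplicites]
-/

set_option autoImplicit false

noncomputable section

open Complex Filter Set MeasureTheory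
open scoped Real Topology ComplexConjugate ContDiff ArithmeticFunction.vonMangoldt

namespace Summit.Ventures.WeilGRH

open Literature.NumberTheory.LFunctions
open Literature.NumberTheory.LFunctions.Yoshida1992 (chi chiCore contDiff_chiCore)
open Summit.RiemannHypothesis.RiemannHypothesis.Theorems.WeilFormatC

variable {q : ℕ} {a : ℝ}

/-! ## Modulation rotates the twist -/

/-- **Modulation rotates the twist**: `D^ω_t(e^{iτ·} u) = D^{ω e^{−iτt}}_t(u)` for every `u : ℝ → ℂ`,
`ω ∈ ℂ`, `τ, t ∈ ℝ` (pointwise `|e^{iτ(x+t)}u(x+t) − ω e^{iτx}u(x)| = |u(x+t) − ω e^{−iτt} u(x)|`). -/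
theorem weilTwistIncrement_modulate (w₀ : ℂ) (u : ℝ → ℂ) (τ t : ℝ) :
    weilTwistIncrement w₀ (fun x ↦ cexp (I * (τ * x : ℝ)) * u x) t =
      weilTwistIncrement (w₀ * cexp (-(I * (τ * t : ℝ)))) u t := by
  unfold weilTwistIncrement
  congr 1
  funext x
  have he : cexp (I * (τ * x : ℝ)) = cexp (I * (τ * (x + t) : ℝ)) * cexp (-(I * (τ * t : ℝ))) := by
    rw [← Complex.exp_add]
    congr 1
    push_cast
    ring
  have h : cexp (I * (τ * (x + t) : ℝ)) * u (x + t) - w₀ * (cexp (I * (τ * x : ℝ)) * u x) =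
      cexp (I * (τ * (x + t) : ℝ)) * (u (x + t) - w₀ * cexp (-(I * (τ * t : ℝ))) * u x) := by
    rw [he]; ring
  rw [h, norm_mul, Complex.norm_exp_I_mul_ofReal, one_mul]

/-- The plain increment of a modulated function is a twisted increment: `D_t(e^{iτ·}u) = D^{e^{−iτt}}_t(u)`. -/
theorem weilIncrement_modulate (u : ℝ → ℂ) (τ t : ℝ) :
    weilIncrement (fun x ↦ cexp (I * (τ * x : ℝ)) * u x) t =
      weilTwistIncrement (cexp (-(I * (τ * t : ℝ)))) u t := by
  have h1 : weilIncrement (fun x ↦ cexp (I * (τ * x : ℝ)) * u x) t =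
      weilTwistIncrement 1 (fun x ↦ cexp (I * (τ * x : ℝ)) * u x) t := by
    simp [weilIncrement, weilTwistIncrement]
  rw [h1, weilTwistIncrement_modulate, one_mul]

/-! ## Elementary facts on `e^{−iθ}` -/

/-- `conj (e^{iθ}) = e^{−iθ}` for real `θ`. -/
theorem conj_cexp_I_mul (θ : ℝ) : conj (cexp (I * θ)) = cexp (-(I * θ)) := by
  rw [← Complex.exp_conj, map_mul, Complex.conj_I, Complex.conj_ofReal, neg_mul]

/-- `Re e^{−iθ} = cos θ`. -/
theorem re_cexp_neg_I_mul (θ : ℝ) : (cexp (-(I * θ))).re = Real.cos θ := by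
  simp [Complex.exp_re, Complex.neg_re, Complex.neg_im, Complex.mul_re, Complex.mul_im, Complex.I_re,
    Complex.I_im, Complex.ofReal_re, Complex.ofReal_im, Real.cos_neg]

/-- `‖1 − e^{−iθ}‖² = 2(1 − cos θ)`. -/
theorem norm_one_sub_cexp_neg_I_mul_sq (θ : ℝ) : ‖1 - cexp (-(I * θ))‖ ^ 2 = 2 * (1 - Real.cos θ) := by
  have hre : (cexp (-(I * θ))).re = Real.cos θ := re_cexp_neg_I_mul θ
  have him : (cexp (-(I * θ))).im = -Real.sin θ := by
    simp [Complex.exp_im, Complex.neg_re, Complex.neg_im, Complex.mul_re, Complex.mul_im, Complex.I_re,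
      Complex.I_im, Complex.ofReal_re, Complex.ofReal_im, Real.sin_neg]
  rw [Complex.sq_norm, Complex.normSq_apply, Complex.sub_re, Complex.sub_im, Complex.one_re,
    Complex.one_im, hre, him]
  nlinarith [Real.sin_sq_add_cos_sq θ]

/-- `‖ω e^{−iθ}‖ = ‖ω‖`. -/
theorem norm_mul_cexp_neg_I_mul (w₀ : ℂ) (θ : ℝ) : ‖w₀ * cexp (-(I * θ))‖ = ‖w₀‖ := by
  rw [norm_mul, show -(I * (θ : ℂ)) = I * ((-θ : ℝ) : ℂ) by push_cast; ring,
    Complex.norm_exp_I_mul_ofReal, mul_one]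

/-! ## The modulated flat window `u_τ = e^{iτx} χ_0` -/

/-- `‖u_τ‖₂² = ‖χ_0‖₂² = 1` (`a > 0`). -/
theorem integral_norm_sq_modulated_chi_zero (ha : 0 < a) (τ : ℝ) :
    ∫ x, ‖cexp (I * (τ * x : ℝ)) * chi a 0 x‖ ^ 2 = 1 := by
  rw [← integral_norm_sq_chi_zero ha]
  refine integral_congr_ae (Eventually.of_forall fun x ↦ ?_)
  simp only [norm_mul, Complex.norm_exp_I_mul_ofReal, one_mul]

/-- `u_τ` is a window function on `[-a, a]` (`a > 0`): measurable, `0` off the window, `‖u_τ‖ ≤ (2a)^{-1/2}`,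
Lipschitz with constant `(2a)^{-1/2}|τ|` on the closed window. -/
theorem isWindowFunction_modulated_chi_zero (ha : 0 < a) (τ : ℝ) :
    IsWindowFunction a (fun x ↦ cexp (I * (τ * x : ℝ)) * chi a 0 x) := by
  have hcont : Continuous fun x : ℝ ↦ cexp (I * (τ * x : ℝ)) :=
    Complex.continuous_exp.comp (continuous_const.mul (Complex.continuous_ofReal.comp
      (continuous_const.mul continuous_id)))
  refine ⟨hcont.measurable.mul (measurable_chi a 0), fun x hx ↦ ?_,
    ⟨1 / Real.sqrt (2 * a), fun x ↦ ?_⟩, ⟨1 / Real.sqrt (2 * a) * |τ|, fun x y hx hy ↦ ?_⟩⟩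
  · simp only [chi_apply_of_not_mem 0 hx, mul_zero]
  · show ‖cexp (I * (τ * x : ℝ)) * chi a 0 x‖ ≤ _
    rw [norm_mul, Complex.norm_exp_I_mul_ofReal, one_mul]; exact norm_chi_le a 0 x
  · show ‖cexp (I * (τ * y : ℝ)) * chi a 0 y - cexp (I * (τ * x : ℝ)) * chi a 0 x‖ ≤ _
    rw [chi_apply_of_mem 0 hx, chi_apply_of_mem 0 hy]
    simp only [Int.cast_zero, mul_zero, zero_mul, zero_div, Complex.exp_zero, mul_one]
    rw [← sub_mul, norm_mul, Complex.norm_real, Real.norm_of_nonneg (by positivity : (0:ℝ) ≤ 1 / Real.sqrt (2 * a)),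
      mul_comm, mul_assoc]
    refine mul_le_mul_of_nonneg_left ?_ (by positivity)
    have key : cexp (I * (τ * y : ℝ)) - cexp (I * (τ * x : ℝ)) =
        cexp (I * (τ * x : ℝ)) * (cexp (I * ((τ * (y - x) : ℝ) : ℂ)) - 1) := by
      rw [mul_sub, mul_one, ← Complex.exp_add]
      congr 2
      push_cast
      ring
    rw [key, norm_mul, Complex.norm_exp_I_mul_ofReal, one_mul]
    refine Real.norm_exp_I_mul_ofReal_sub_one_le.trans ?_
    rw [Real.norm_eq_abs, abs_mul]

/-- `u_τ` agrees on the closed window with the smooth function `e^{iτx} χ_0^{core}(x)`. -/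
theorem modulated_chi_zero_smooth_inside (a τ : ℝ) :
    ContDiff ℝ ∞ (fun x : ℝ ↦ cexp (I * (τ * x : ℝ)) * chiCore a 0 x) ∧
      ∀ x ∈ Icc (-a) a, cexp (I * (τ * x : ℝ)) * chi a 0 x = cexp (I * (τ * x : ℝ)) * chiCore a 0 x := by
  refine ⟨?_, fun x hx ↦ by rw [chi_eq_chiCore_of_mem 0 hx]⟩
  have h1 : ContDiff ℝ ∞ (fun x : ℝ ↦ (I * (τ * x : ℝ) : ℂ)) := by
    have : ContDiff ℝ ∞ (fun x : ℝ ↦ ((τ * x : ℝ) : ℂ)) :=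
      Complex.ofRealCLM.contDiff.comp (contDiff_const.mul contDiff_id)
    exact contDiff_const.mul this
  exact ((Complex.contDiff_exp (𝕜 := ℝ)).comp h1).mul (contDiff_chiCore a 0)

/-- **Twisted increments of the modulated flat window**:
`D^ω_t(u_τ) = ‖1 − ω e^{−iτt}‖² + Re(ω e^{−iτt})·min(t, 2a)/a` (`t ≥ 0`, `a > 0`). -/
theorem weilTwistIncrement_modulated_chi_zero (ha : 0 < a) (w₀ : ℂ) (τ : ℝ) {t : ℝ} (ht : 0 ≤ t) :
    weilTwistIncrement w₀ (fun x ↦ cexp (I * (τ * x : ℝ)) * chi a 0 x) t =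
      ‖1 - w₀ * cexp (-(I * (τ * t : ℝ)))‖ ^ 2 + (w₀ * cexp (-(I * (τ * t : ℝ)))).re * (min t (2 * a) / a) := by
  rw [weilTwistIncrement_modulate, weilTwistIncrement_chi_zero ha _ ht]

/-- **Increments of the modulated flat window**: `D_t(u_τ) = 2(1 − cos τt) + cos(τt)·min(t, 2a)/a`. -/
theorem weilIncrement_modulated_chi_zero (ha : 0 < a) (τ : ℝ) {t : ℝ} (ht : 0 ≤ t) :
    weilIncrement (fun x ↦ cexp (I * (τ * x : ℝ)) * chi a 0 x) t =
      2 * (1 - Real.cos (τ * t)) + Real.cos (τ * t) * (min t (2 * a) / a) := by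
  rw [weilIncrement_modulate, weilTwistIncrement_chi_zero ha _ ht, norm_one_sub_cexp_neg_I_mul_sq,
    re_cexp_neg_I_mul]

/-! ## The twisted window form of the modulated flat window, in closed form -/

/-- Per prime power, with the rotated key `z = χ(n) e^{iτ log n}`:
`‖1 − conj(χ(n)) e^{−iτL}‖² + Re(conj(χ(n)) e^{−iτL})·L/a − (1 + ‖χ(n)‖²) = −2(1 − L/(2a)) Re z`. -/
private theorem key_term_identity_mod (c : ℂ) (τ L : ℝ) (ha : a ≠ 0) :
    ‖1 - conj c * cexp (-(I * (τ * L : ℝ)))‖ ^ 2 + (conj c * cexp (-(I * (τ * L : ℝ)))).re * (L / a) -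
        (1 + ‖c‖ ^ 2) =
      -(2 * ((1 - L / (2 * a)) * (c * cexp (I * (τ * L : ℝ))).re)) := by
  have hz : conj c * cexp (-(I * (τ * L : ℝ))) = conj (c * cexp (I * (τ * L : ℝ))) := by
    rw [map_mul, conj_cexp_I_mul]
  have hn : ‖c‖ = ‖c * cexp (I * (τ * L : ℝ))‖ := by
    rw [norm_mul, Complex.norm_exp_I_mul_ofReal, mul_one]
  rw [hz, hn]
  set z := c * cexp (I * (τ * L : ℝ))
  rw [Complex.sq_norm, Complex.sq_norm, Complex.normSq_apply, Complex.normSq_apply]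
  simp only [Complex.sub_re, Complex.one_re, Complex.conj_re, Complex.sub_im, Complex.one_im,
    Complex.conj_im, sub_neg_eq_add]
  field_simp
  ring

/-- **THE TWISTED WINDOW FORM OF THE MODULATED FLAT WINDOW, IN CLOSED FORM** (`a > 0`, any `χ` mod `q`,
any `τ ∈ ℝ`; `κ = a_χ`, `ρ_κ(t) = e^{(1/2−κ)t}/(2 sinh t)`, `n^{iτ} = e^{iτ log n}`):
`𝓔^χ_a(u_τ) − M^χ_a‖u_τ‖₂² = log q − [2Σ_{log n<2a} Λ(n)n^{-1/2}(1 − log n/(2a)) Re(χ(n)n^{iτ}) + K_κ`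
  `− ∫₀^∞ ρ_κ(t)(2(1 − cos τt) + cos(τt) min(t,2a)/a) dt]`. -/
theorem twistedWindowForm_modulated_chi_zero (χ : DirichletCharacter ℂ q) (ha : 0 < a) (τ : ℝ) :
    weilDirichletEnergyChar χ a (fun x ↦ cexp (I * (τ * x : ℝ)) * chi a 0 x) -
        weilMarkovConstantChar χ a * ∫ x : ℝ, ‖cexp (I * (τ * x : ℝ)) * chi a 0 x‖ ^ 2 =
      Real.log q -
        (2 * (∑ n ∈ weilPrimeIndex a, (Λ n : ℝ) / Real.sqrt n *
              ((1 - Real.log n / (2 * a)) * (χ (n : ZMod q) * cexp (I * (τ * Real.log n : ℝ))).re)) +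
          (Real.log (4 * π) + Real.eulerMascheroniConstant +
            2 * ∫ t in Ioi (0 : ℝ), weilKillingDensityPar (charParity χ) t) -
          ∫ t in Ioi (0 : ℝ), weilArchDensityPar (charParity χ) t *
            (2 * (1 - Real.cos (τ * t)) + Real.cos (τ * t) * (min t (2 * a) / a))) := by
  rw [integral_norm_sq_modulated_chi_zero ha, mul_one]
  unfold weilDirichletEnergyChar weilMarkovConstantChar
  have hprime : ∑ n ∈ weilPrimeIndex a, (Λ n : ℝ) / Real.sqrt n *
        weilTwistIncrement (conj (χ (n : ZMod q))) (fun x ↦ cexp (I * (τ * x : ℝ)) * chi a 0 x)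
          (Real.log n) =
      ∑ n ∈ weilPrimeIndex a, (Λ n : ℝ) / Real.sqrt n *
        (‖1 - conj (χ (n : ZMod q)) * cexp (-(I * (τ * Real.log n : ℝ)))‖ ^ 2 +
          (conj (χ (n : ZMod q)) * cexp (-(I * (τ * Real.log n : ℝ)))).re * (Real.log n / a)) := by
    refine Finset.sum_congr rfl fun n hn ↦ ?_
    have hlog : Real.log n < 2 * a := mem_weilPrimeIndex.1 hn
    rw [weilTwistIncrement_modulated_chi_zero ha _ τ (Real.log_natCast_nonneg n), min_eq_left hlog.le]
  have harch : ∫ t in Ioi (0 : ℝ), weilArchDensityPar (charParity χ) t *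
        weilIncrement (fun x ↦ cexp (I * (τ * x : ℝ)) * chi a 0 x) t =
      ∫ t in Ioi (0 : ℝ), weilArchDensityPar (charParity χ) t *
        (2 * (1 - Real.cos (τ * t)) + Real.cos (τ * t) * (min t (2 * a) / a)) :=
    setIntegral_congr_fun measurableSet_Ioi fun t (ht : 0 < t) ↦ by
      rw [weilIncrement_modulated_chi_zero ha τ ht.le]
  rw [hprime, harch]
  have hsum : (∑ n ∈ weilPrimeIndex a, (Λ n : ℝ) / Real.sqrt n *
        (‖1 - conj (χ (n : ZMod q)) * cexp (-(I * (τ * Real.log n : ℝ)))‖ ^ 2 +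
          (conj (χ (n : ZMod q)) * cexp (-(I * (τ * Real.log n : ℝ)))).re * (Real.log n / a))) -
      ∑ n ∈ weilPrimeIndex a, (Λ n : ℝ) / Real.sqrt n * (1 + ‖χ (n : ZMod q)‖ ^ 2) =
      -(2 * ∑ n ∈ weilPrimeIndex a, (Λ n : ℝ) / Real.sqrt n *
          ((1 - Real.log n / (2 * a)) * (χ (n : ZMod q) * cexp (I * (τ * Real.log n : ℝ))).re)) := by
    rw [← Finset.sum_sub_distrib, Finset.mul_sum, ← Finset.sum_neg_distrib]
    refine Finset.sum_congr rfl fun n _ ↦ ?_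
    rw [← mul_sub, key_term_identity_mod _ _ _ ha.ne']
    ring
  linarith [hsum]

/-! ## The modulated flat-window inequality -/

/-- **THE MODULATED FLAT-WINDOW INEQUALITY — a `χ`-rung bounds every twisted smoothed prime sum below
its horizon, at every height.**  For every Dirichlet character `χ` mod `q ≠ 1`, every `a > 0` and every
`τ ∈ ℝ`: if `WeilPositivityOnChar χ a`, then

  `2Σ_{log n<2a} Λ(n)n^{-1/2}(1 − log n/(2a)) Re(χ(n) n^{iτ}) + K_κ`
    `− ∫₀^∞ ρ_κ(t)(2(1 − cos τt) + cos(τt) min(t, 2a)/a) dt ≤ log q`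

(`K_κ = log 4π + γ + 2∫₀^∞(e^{(1/2−κ)t} − 1)dt/(2 sinh t)`).  At `τ = 0` this is
`flatWindow_le_log_of_weilPositivityOnChar`.  RH/GRH-free. -/
theorem modulatedFlatWindow_le_log_of_weilPositivityOnChar (hq : q ≠ 1) (χ : DirichletCharacter ℂ q)
    (ha : 0 < a) (hW : WeilPositivityOnChar χ a) (τ : ℝ) :
    2 * (∑ n ∈ weilPrimeIndex a, (Λ n : ℝ) / Real.sqrt n *
          ((1 - Real.log n / (2 * a)) * (χ (n : ZMod q) * cexp (I * (τ * Real.log n : ℝ))).re)) +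
        (Real.log (4 * π) + Real.eulerMascheroniConstant +
          2 * ∫ t in Ioi (0 : ℝ), weilKillingDensityPar (charParity χ) t) -
        ∫ t in Ioi (0 : ℝ), weilArchDensityPar (charParity χ) t *
          (2 * (1 - Real.cos (τ * t)) + Real.cos (τ * t) * (min t (2 * a) / a)) ≤
      Real.log q := by
  obtain ⟨hf, huf⟩ := modulated_chi_zero_smooth_inside a τ
  have h := twistedWindowForm_nonneg_of_weilPositivityOnChar hq χ ha hW
    (isWindowFunction_modulated_chi_zero ha τ) hf huf
  rw [twistedWindowForm_modulated_chi_zero χ ha τ] at h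
  linarith

/-- **Under `GRH(χ)`** (`χ` primitive mod `q ≠ 1`): the modulated flat-window inequality at every window
`a > 0` and every height `τ` — `GRH(χ)` as a uniform family of explicit upper bounds for the twisted prime
sums `Σ_{n<e^{2a}} Λ(n)χ(n)n^{-1/2+iτ}(1 − log n/(2a))`. -/
theorem modulatedFlatWindow_le_log_of_grh [NeZero q] (hq : q ≠ 1) {χ : DirichletCharacter ℂ q}
    (hprim : χ.IsPrimitive) (hGRH : χ.RiemannHypothesis) (ha : 0 < a) (τ : ℝ) :
    2 * (∑ n ∈ weilPrimeIndex a, (Λ n : ℝ) / Real.sqrt n *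
          ((1 - Real.log n / (2 * a)) * (χ (n : ZMod q) * cexp (I * (τ * Real.log n : ℝ))).re)) +
        (Real.log (4 * π) + Real.eulerMascheroniConstant +
          2 * ∫ t in Ioi (0 : ℝ), weilKillingDensityPar (charParity χ) t) -
        ∫ t in Ioi (0 : ℝ), weilArchDensityPar (charParity χ) t *
          (2 * (1 - Real.cos (τ * t)) + Real.cos (τ * t) * (min t (2 * a) / a)) ≤
      Real.log q :=
  modulatedFlatWindow_le_log_of_weilPositivityOnChar hq χ ha ((WeilPositivityChar.of_grh hq hprim hGRH).on a) τ

end Summit.Ventures.WeilGRH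

end
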